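import Mathlib.Analysis.SpecialFunctions.Sqrt
import Mathlib.Analysis.SpecialFunctions.JapaneseBracket
import Literature.Analysis.FluidPDE.TsaiHeadPressure
import Literature.Analysis.FluidPDE.RadialCalculus
import HarnessLib

/-!
# The regularised Stokeslet potential on `ℝ³`: profiles, coordinate derivatives, bounds

Analysis/FluidPDE support file (all results proved) for the discharge of the named fact
`Literature.Analysis.FluidPDE.tsai1998_lemma33` (T.-P. Tsai, *On Leray's self-similar solutions of
the Navier–Stokes equations satisfying local energy estimates*, Arch. Rational Mech. Anal. 143
(1998) 29–51, **Lemma 3.3**: a weak solution `U ∈ L^q(ℝ³)`, `3 < q < ∞`, of Leray's profile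
system satisfies `U(y) = o(|y|)`). Tsai proves Lemma 3.3 (§3.3, pp. 39–42) with Green's
representation formula for the Stokes system on balls `B_ρ(y₀)` and the estimates (3.6)–(3.9)
of the Green tensor (Cattabriga; Galdi, vol. I, pp. 226–234), none of which is in Mathlib. The
sequel `LerayProfileRepresentation` replaces the Green tensor of the ball by a compactly
supported, exactly divergence-free test field built from the **regularised Stokeslet** of
Cortez (the method of regularised Stokeslets): with the regularised biharmonic potential

  `Φ_ε(x) = -√(|x|² + ε²)`,   `Eᵢⱼ = ∂ᵢ∂ⱼΦ_ε − δᵢⱼ ΔΦ_ε = (δᵢⱼ(|x|² + 2ε²) + xᵢxⱼ)(|x|² + ε²)^{-3/2}`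

(`8π ν` times Cortez' regularised Stokeslet), one has `∑ᵢ ∂ᵢEᵢⱼ = 0` and
`ΔEᵢⱼ = ∂ᵢ∂ⱼΔΦ_ε − δᵢⱼ Ψ_ε` with the positive, integrable bump

  `Ψ_ε = Δ²Φ_ε = 15 ε⁴ (|x|² + ε²)^{-7/2} = ε⁻³ Ψ₁(x/ε)`,

an approximate identity. This file is pure calculus on `ℝ³ = EuclideanSpace ℝ (Fin 3)` in the
coordinate partial derivatives `pderiv` of `CoordDerivatives`:

* `Stokeslet.rt/g0/…/g4/G0/G1/G2/psi`: the radial profiles in `s = |x|²` (`t = √(s+ε²)`,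
  `g₀ = −t`, `gₖ₊₁ = gₖ'`, `G₀ = 4s g₂ + 6 g₁` = profile of `ΔΦ_ε`, `G₁ = G₀'`, `G₂ = G₁'`,
  `ψ = 4s G₂ + 6 G₁` = profile of `Δ²Φ_ε`), their derivatives (`hasDerivAt_g0` …), the closed
  forms `G₀ = −(2s+3ε²)/t³`, `G₁ = (2s+5ε²)/(2t⁵)`, `ψ = 15ε⁴/t⁷ > 0` (`psi_eq`), and the bounds
  `|g₁| = 1/(2t)`, `|g₂| = 1/(4t³)`, `|g₃| = 3/(8t⁵)`, `|G₀| ≤ 3/t`, `|G₁| ≤ 5/(2t³)`;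
* `Stokeslet.Phi/D1/D2/D3/Lap/E1/E2/Psi`: `Φ_ε` and the explicit functions
  `∂ᵢΦ_ε`, `∂ₖ∂ᵢΦ_ε`, `∂ₗ∂ₖ∂ᵢΦ_ε`, `ΔΦ_ε`, `∂ᵢΔΦ_ε`, `∂ₖ∂ᵢΔΦ_ε`, `Δ²Φ_ε`, with the chain of
  identities `pderiv_Phi`, `pderiv_D1`, `pderiv_D2`, `sum_D2_diag`, `pderiv_Lap`, `pderiv_E1`,
  `sum_E2_diag`, `sum_D3_diag` (all for `ε ≠ 0`, where everything is smooth);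
* the bounds, uniform in `ε ≠ 0`: `|∂Φ_ε| ≤ 1`, `|∂²Φ_ε| ≤ 2/|x|`, `|∂³Φ_ε| ≤ 6/|x|²`,
  `|ΔΦ_ε| ≤ 3/|x|`, `|∂ΔΦ_ε| ≤ 5/|x|²` (`abs_D1_le` … `abs_E1_le`);
* the bump: `Psi_eq`, `Psi_pos`, the scaling `Ψ_ε(x) = ε⁻³Ψ₁(ε⁻¹x)` (`Psi_scale`),
  `Ψ₁ = 15(1+|u|²)^{-7/2} ∈ L¹` (`integrable_Psi_one`, Mathlib's
  `integrable_rpow_neg_one_add_norm_sq`), `∫Ψ₁ > 0`, and the decay `‖u‖³Ψ₁(u) → 0` needed by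
  Mathlib's approximate-identity lemma `tendsto_integral_comp_smul_smul_of_integrable`.

Nothing here involves the Navier–Stokes equations; the constant `8π` and the value `∫Ψ₁ = 8π`
are never needed (only `0 < ∫Ψ₁ < ∞`), so they are not computed.

## References

* R. Cortez, *The method of regularized Stokeslets*, SIAM J. Sci. Comput. 23 (2001) 1204–1225,
  §2 (the blob `ψ_ε = 15ε⁴/(8π(r²+ε²)^{7/2})` and its Stokeslet). [folklore formulas]
* T.-P. Tsai, *On Leray's self-similar solutions of the Navier–Stokes equations satisfying local
  energy estimates*, Arch. Rational Mech. Anal. 143 (1998) 29–51, §3.3 [Tsai1998].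
* G. P. Galdi, *An introduction to the mathematical theory of the Navier–Stokes equations*, I,
  Springer (1994), IV.2 (the Stokes fundamental solution `(∂ᵢ∂ⱼ − δᵢⱼΔ)(−|x|/8π)`).
-/

noncomputable section

open MeasureTheory Set Filter Topology InnerProductSpace Function Real
open scoped RealInnerProductSpace ContDiff BigOperators

namespace Literature.Analysis.FluidPDE

namespace Stokeslet

/-! ### The radial profiles in the variable `s = |x|²` -/

section Profiles

variable (ε : ℝ)

/-- `t(s) = √(s + ε²)`, the regularised radius as a function of `s = |x|²`. [folklore] -/
def rt (s : ℝ) : ℝ := Real.sqrt (s + ε ^ 2)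

/-- The profile of the regularised biharmonic potential `Φ_ε(x) = -√(|x|² + ε²)`:
`g₀(s) = -t(s)`. [folklore] -/
def g0 (s : ℝ) : ℝ := -rt ε s

/-- `g₁ = g₀' = -1/(2t)`. [folklore] -/
def g1 (s : ℝ) : ℝ := -1 / (2 * rt ε s)

/-- `g₂ = g₁' = 1/(4t³)`. [folklore] -/
def g2 (s : ℝ) : ℝ := 1 / (4 * rt ε s ^ 3)

/-- `g₃ = g₂' = -3/(8t⁵)`. [folklore] -/
def g3 (s : ℝ) : ℝ := -3 / (8 * rt ε s ^ 5)

/-- `g₄ = g₃' = 15/(16t⁷)`. [folklore] -/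
def g4 (s : ℝ) : ℝ := 15 / (16 * rt ε s ^ 7)

/-- The profile of `ΔΦ_ε` in dimension three: `G₀ = 4 s g₂ + 6 g₁` (`= -(2s+3ε²)/t³`). [folklore] -/
def G0 (s : ℝ) : ℝ := 4 * s * g2 ε s + 6 * g1 ε s

/-- `G₁ = G₀' = 10 g₂ + 4 s g₃` (`= (2s + 5ε²)/(2t⁵)`). [folklore] -/
def G1 (s : ℝ) : ℝ := 10 * g2 ε s + 4 * s * g3 ε s

/-- `G₂ = G₁' = 14 g₃ + 4 s g₄`. [folklore] -/
def G2 (s : ℝ) : ℝ := 14 * g3 ε s + 4 * s * g4 ε s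

/-- The profile of `Δ²Φ_ε` in dimension three: `ψ = 4 s G₂ + 6 G₁` (`= 15 ε⁴ / t⁷`). [folklore] -/
def psi (s : ℝ) : ℝ := 4 * s * G2 ε s + 6 * G1 ε s

variable {ε}

/-- `t(s) > 0` for `ε ≠ 0`, `s ≥ 0`. [folklore] -/
theorem rt_pos (hε : ε ≠ 0) {s : ℝ} (hs : 0 ≤ s) : 0 < rt ε s :=
  Real.sqrt_pos.2 (by positivity)

/-- `t(s)² = s + ε²` for `s ≥ 0`. [folklore] -/
theorem rt_sq {s : ℝ} (hs : 0 ≤ s) : rt ε s ^ 2 = s + ε ^ 2 :=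
  Real.sq_sqrt (by positivity)

/-- `√s ≤ t(s)`. [folklore] -/
theorem sqrt_le_rt (s : ℝ) : Real.sqrt s ≤ rt ε s :=
  Real.sqrt_le_sqrt (by nlinarith [sq_nonneg ε])


/-- `|ε| ≤ t(s)` for `s ≥ 0`. [folklore] -/
theorem abs_eps_le_rt {s : ℝ} (hs : 0 ≤ s) : |ε| ≤ rt ε s := by
  rw [← Real.sqrt_sq_eq_abs]
  exact Real.sqrt_le_sqrt (by linarith)

/-- `t' = 1/(2t)`. [folklore] -/
theorem hasDerivAt_rt (hε : ε ≠ 0) {s : ℝ} (hs : 0 ≤ s) :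
    HasDerivAt (rt ε) (1 / (2 * rt ε s)) s := by
  have h : HasDerivAt (fun s => s + ε ^ 2) 1 s := (hasDerivAt_id' s).add_const _
  have h2 := h.sqrt (by positivity)
  exact h2

/-- `g₀' = g₁`. [folklore] -/
theorem hasDerivAt_g0 (hε : ε ≠ 0) {s : ℝ} (hs : 0 ≤ s) : HasDerivAt (g0 ε) (g1 ε s) s := by
  have h := (hasDerivAt_rt hε hs).neg
  refine h.congr_deriv ?_
  rw [g1]
  ring

/-- `g₁' = g₂`. [folklore] -/
theorem hasDerivAt_g1 (hε : ε ≠ 0) {s : ℝ} (hs : 0 ≤ s) : HasDerivAt (g1 ε) (g2 ε s) s := by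
  have ht := rt_pos hε hs
  have h1 : HasDerivAt (fun s => (rt ε s)⁻¹) (-(1 / (2 * rt ε s)) / rt ε s ^ 2) s :=
    (hasDerivAt_rt hε hs).inv ht.ne'
  have h2 := h1.const_mul (-1 / 2)
  have e : g1 ε = fun s => -1 / 2 * (rt ε s)⁻¹ := by
    funext s; simp only [g1]; ring
  rw [e]
  refine h2.congr_deriv ?_
  rw [g2]
  field_simp
  ring

/-- `g₂' = g₃`. [folklore] -/
theorem hasDerivAt_g2 (hε : ε ≠ 0) {s : ℝ} (hs : 0 ≤ s) : HasDerivAt (g2 ε) (g3 ε s) s := by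
  have ht := rt_pos hε hs
  have h1 : HasDerivAt (fun s => rt ε s ^ 3) (3 * rt ε s ^ 2 * (1 / (2 * rt ε s))) s :=
    (hasDerivAt_rt hε hs).pow 3
  have h2 : HasDerivAt (fun s => (rt ε s ^ 3)⁻¹)
      (-(3 * rt ε s ^ 2 * (1 / (2 * rt ε s))) / (rt ε s ^ 3) ^ 2) s := h1.inv (by positivity)
  have h3 := h2.const_mul (1 / 4)
  have e : g2 ε = fun s => 1 / 4 * (rt ε s ^ 3)⁻¹ := by
    funext s; simp only [g2]; ring
  rw [e]
  refine h3.congr_deriv ?_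
  rw [g3]
  field_simp
  ring

/-- `g₃' = g₄`. [folklore] -/
theorem hasDerivAt_g3 (hε : ε ≠ 0) {s : ℝ} (hs : 0 ≤ s) : HasDerivAt (g3 ε) (g4 ε s) s := by
  have ht := rt_pos hε hs
  have h1 : HasDerivAt (fun s => rt ε s ^ 5) (5 * rt ε s ^ 4 * (1 / (2 * rt ε s))) s :=
    (hasDerivAt_rt hε hs).pow 5
  have h2 : HasDerivAt (fun s => (rt ε s ^ 5)⁻¹)
      (-(5 * rt ε s ^ 4 * (1 / (2 * rt ε s))) / (rt ε s ^ 5) ^ 2) s := h1.inv (by positivity)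
  have h3 := h2.const_mul (-3 / 8)
  have e : g3 ε = fun s => -3 / 8 * (rt ε s ^ 5)⁻¹ := by
    funext s; simp only [g3]; ring
  rw [e]
  refine h3.congr_deriv ?_
  rw [g4]
  field_simp
  ring

/-- `G₀' = G₁`. [folklore] -/
theorem hasDerivAt_G0 (hε : ε ≠ 0) {s : ℝ} (hs : 0 ≤ s) : HasDerivAt (G0 ε) (G1 ε s) s := by
  have ha : HasDerivAt (fun s => 4 * s * g2 ε s) (4 * 1 * g2 ε s + 4 * s * g3 ε s) s :=
    ((hasDerivAt_id' s).const_mul (4 : ℝ)).mul (hasDerivAt_g2 hε hs)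
  have hb : HasDerivAt (fun s => 6 * g1 ε s) (6 * g2 ε s) s := (hasDerivAt_g1 hε hs).const_mul 6
  have h := ha.add hb
  show HasDerivAt (fun s => 4 * s * g2 ε s + 6 * g1 ε s) (G1 ε s) s
  refine h.congr_deriv ?_
  rw [G1]
  ring

/-- `G₁' = G₂`. [folklore] -/
theorem hasDerivAt_G1 (hε : ε ≠ 0) {s : ℝ} (hs : 0 ≤ s) : HasDerivAt (G1 ε) (G2 ε s) s := by
  have ha : HasDerivAt (fun s => 10 * g2 ε s) (10 * g3 ε s) s := (hasDerivAt_g2 hε hs).const_mul 10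
  have hb : HasDerivAt (fun s => 4 * s * g3 ε s) (4 * 1 * g3 ε s + 4 * s * g4 ε s) s :=
    ((hasDerivAt_id' s).const_mul (4 : ℝ)).mul (hasDerivAt_g3 hε hs)
  have h := ha.add hb
  show HasDerivAt (fun s => 10 * g2 ε s + 4 * s * g3 ε s) (G2 ε s) s
  refine h.congr_deriv ?_
  rw [G2]
  ring

/-- Closed form of the Laplacian profile: `G₀(s) = -(2s + 3ε²)/t³`. [folklore] -/
theorem G0_eq (hε : ε ≠ 0) {s : ℝ} (hs : 0 ≤ s) : G0 ε s = -(2 * s + 3 * ε ^ 2) / rt ε s ^ 3 := by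
  have ht := rt_pos hε hs
  have hsq := rt_sq (ε := ε) hs
  simp only [G0, g1, g2]
  field_simp
  nlinarith [hsq]

/-- Closed form: `G₁(s) = (2s + 5ε²)/(2t⁵)`. [folklore] -/
theorem G1_eq (hε : ε ≠ 0) {s : ℝ} (hs : 0 ≤ s) : G1 ε s = (2 * s + 5 * ε ^ 2) / (2 * rt ε s ^ 5) := by
  have ht := rt_pos hε hs
  have hsq := rt_sq (ε := ε) hs
  simp only [G1, g2, g3]
  field_simp
  nlinarith [hsq]

/-- **`Δ²Φ_ε` is a positive bump**: `ψ(s) = 15 ε⁴ / t⁷`. [folklore] -/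
theorem psi_eq (hε : ε ≠ 0) {s : ℝ} (hs : 0 ≤ s) : psi ε s = 15 * ε ^ 4 / rt ε s ^ 7 := by
  have ht := rt_pos hε hs
  have hsq := rt_sq (ε := ε) hs
  simp only [psi, G1, G2, g2, g3, g4]
  field_simp
  have e4 : rt ε s ^ 4 = (s + ε ^ 2) ^ 2 := by rw [← hsq]; ring
  nlinarith [hsq, e4]

/-- `ψ > 0` for `ε ≠ 0`. [folklore] -/
theorem psi_pos (hε : ε ≠ 0) {s : ℝ} (hs : 0 ≤ s) : 0 < psi ε s := by
  rw [psi_eq hε hs]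
  have ht := rt_pos hε hs
  positivity

/-! Bounds: `|g₁| = 1/(2t)`, `|g₂| = 1/(4t³)`, `|g₃| = 3/(8t⁵)`, `|G₀| ≤ 3/t`, `|G₁| ≤ 5/(2t³)`. -/

/-- `|g₁| = 1/(2t)`. [folklore] -/
theorem abs_g1 (hε : ε ≠ 0) {s : ℝ} (hs : 0 ≤ s) : |g1 ε s| = 1 / (2 * rt ε s) := by
  have ht := rt_pos hε hs
  rw [g1, abs_div, abs_of_pos (by positivity : (0:ℝ) < 2 * rt ε s)]
  norm_num

/-- `|g₂| = 1/(4t³)`. [folklore] -/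
theorem abs_g2 (hε : ε ≠ 0) {s : ℝ} (hs : 0 ≤ s) : |g2 ε s| = 1 / (4 * rt ε s ^ 3) := by
  have ht := rt_pos hε hs
  rw [g2, abs_of_pos (by positivity)]

/-- `|g₃| = 3/(8t⁵)`. [folklore] -/
theorem abs_g3 (hε : ε ≠ 0) {s : ℝ} (hs : 0 ≤ s) : |g3 ε s| = 3 / (8 * rt ε s ^ 5) := by
  have ht := rt_pos hε hs
  rw [g3, abs_div, abs_of_pos (by positivity : (0:ℝ) < 8 * rt ε s ^ 5)]
  norm_num

/-- `|G₀| ≤ 3/t` (`2s + 3ε² ≤ 3t²`). [folklore] -/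
theorem abs_G0_le (hε : ε ≠ 0) {s : ℝ} (hs : 0 ≤ s) : |G0 ε s| ≤ 3 / rt ε s := by
  have ht := rt_pos hε hs
  have hsq := rt_sq (ε := ε) hs
  rw [G0_eq hε hs, abs_div, abs_neg, abs_of_nonneg (by positivity), abs_of_pos (by positivity),
    div_le_div_iff₀ (by positivity) ht]
  have : (2 * s + 3 * ε ^ 2) ≤ 3 * rt ε s ^ 2 := by rw [hsq]; nlinarith
  nlinarith [this, ht]

/-- `|G₁| ≤ 5/(2t³)` (`2s + 5ε² ≤ 5t²`). [folklore] -/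
theorem abs_G1_le (hε : ε ≠ 0) {s : ℝ} (hs : 0 ≤ s) : |G1 ε s| ≤ 5 / (2 * rt ε s ^ 3) := by
  have ht := rt_pos hε hs
  have hsq := rt_sq (ε := ε) hs
  rw [G1_eq hε hs, abs_div, abs_of_nonneg (by positivity), abs_of_pos (by positivity),
    div_le_div_iff₀ (by positivity) (by positivity)]
  have : (2 * s + 5 * ε ^ 2) ≤ 5 * rt ε s ^ 2 := by rw [hsq]; nlinarith
  nlinarith [this, ht, pow_pos ht 3]

end Profiles

/-! ### Coordinate derivatives of radial functions on `ℝ³` -/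

section Radial

/-- Local notation for physical space `ℝ³ = EuclideanSpace ℝ (Fin 3)`. -/
local notation "𝔼" => EuclideanSpace ℝ (Fin 3)

/-- The Kronecker delta as a real number. [folklore] -/
def kd (k i : Fin 3) : ℝ := if k = i then 1 else 0

/-- `δₖₖ = 1`. [folklore] -/
@[simp] theorem kd_self (k : Fin 3) : kd k k = 1 := by simp [kd]

/-- `δₖᵢ = δᵢₖ`. [folklore] -/
theorem kd_comm (k i : Fin 3) : kd k i = kd i k := by
  unfold kd; split_ifs with h1 h2 h2 <;> first | rfl | exact absurd h1.symm h2 |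
    exact absurd h2.symm h1

/-- `δₖᵢ = 0` for `k ≠ i`. [folklore] -/
theorem kd_of_ne {k i : Fin 3} (h : k ≠ i) : kd k i = 0 := by simp [kd, h]

/-- `∂ₗ (h(‖·‖²)) = 2 h'(‖x‖²) xₗ` for a profile `h` differentiable at every `‖x‖²`. [folklore] -/
theorem pderiv_comp_norm_sq {h h' : ℝ → ℝ} (hh : ∀ x : 𝔼, HasDerivAt h (h' (‖x‖ ^ 2)) (‖x‖ ^ 2))
    (l : Fin 3) : pderiv l (fun x : 𝔼 => h (‖x‖ ^ 2)) = fun x => 2 * h' (‖x‖ ^ 2) * x l := by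
  funext x
  rw [pderiv_apply, fderiv_comp_norm_sq_apply (hh x)]
  simp [stdVec, EuclideanSpace.inner_single_right]

/-- A radial function with a profile differentiable at every `‖x‖²` is differentiable. [folklore] -/
theorem differentiable_comp_norm_sq {h h' : ℝ → ℝ}
    (hh : ∀ x : 𝔼, HasDerivAt h (h' (‖x‖ ^ 2)) (‖x‖ ^ 2)) :
    Differentiable ℝ (fun x : 𝔼 => h (‖x‖ ^ 2)) :=
  fun x => (hasFDerivAt_comp_norm_sq (hh x)).differentiableAt

/-- `∂ₗ xᵢ = δᵢₗ` with the real Kronecker delta. [folklore] -/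
theorem pderiv_coord (i l : Fin 3) : pderiv l (fun y : 𝔼 => y i) = fun _ => kd i l := by
  rw [pderiv_euclideanCoord]; rfl

/-- `‖x‖² = ∑ᵢ xᵢ²` on `ℝ³`, expanded. [folklore] -/
theorem norm_sq_eq_three (x : 𝔼) : ‖x‖ ^ 2 = x 0 * x 0 + x 1 * x 1 + x 2 * x 2 := by
  rw [EuclideanSpace.real_norm_sq_eq, Fin.sum_univ_three]; ring

/-- `|xᵢ| ≤ ‖x‖`. [folklore] -/
theorem abs_coord_le_norm (x : 𝔼) (i : Fin 3) : |x i| ≤ ‖x‖ := by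
  have h1 : (x i) ^ 2 ≤ ‖x‖ ^ 2 := by
    rw [EuclideanSpace.real_norm_sq_eq]
    exact Finset.single_le_sum (f := fun j => (x j) ^ 2) (fun j _ => sq_nonneg _) (Finset.mem_univ i)
  exact abs_le_of_sq_le_sq' h1 (norm_nonneg _) |> fun h => abs_le.2 h

end Radial

/-! ### The regularised potential `Φ_ε` and its coordinate derivatives up to order three -/

section Potential

/-- Local notation for physical space `ℝ³ = EuclideanSpace ℝ (Fin 3)`. -/
local notation "𝔼" => EuclideanSpace ℝ (Fin 3)

variable (ε : ℝ)

/-- The regularised biharmonic potential `Φ_ε(x) = -√(|x|² + ε²)` (Cortez 2001, regularised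
Stokeslets: `Δ²Φ_ε` is the blob `15ε⁴/(8π(|x|²+ε²)^{7/2})` up to the factor `8π`). [folklore] -/
def Phi (x : 𝔼) : ℝ := g0 ε (‖x‖ ^ 2)

/-- `∂ᵢΦ_ε = 2 g₁(|x|²) xᵢ` (`= -xᵢ/t`). [folklore] -/
def D1 (i : Fin 3) (x : 𝔼) : ℝ := 2 * g1 ε (‖x‖ ^ 2) * x i

/-- `∂ₖ∂ᵢΦ_ε = 4 g₂ xₖ xᵢ + 2 g₁ δₖᵢ`. [folklore] -/
def D2 (k i : Fin 3) (x : 𝔼) : ℝ := 4 * g2 ε (‖x‖ ^ 2) * x k * x i + 2 * g1 ε (‖x‖ ^ 2) * kd k i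

/-- `∂ₗ∂ₖ∂ᵢΦ_ε = 8 g₃ xₗxₖxᵢ + 4 g₂ (δₖₗ xᵢ + δᵢₗ xₖ + δₖᵢ xₗ)`. [folklore] -/
def D3 (l k i : Fin 3) (x : 𝔼) : ℝ :=
  8 * g3 ε (‖x‖ ^ 2) * x l * x k * x i +
    4 * g2 ε (‖x‖ ^ 2) * (kd k l * x i + kd i l * x k + kd k i * x l)

/-- `ΔΦ_ε = G₀(|x|²)` (`= ∑ₖ ∂ₖ∂ₖΦ_ε`, `sum_D2_diag`). [folklore] -/
def Lap (x : 𝔼) : ℝ := G0 ε (‖x‖ ^ 2)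

/-- `∂ᵢΔΦ_ε = 2 G₁(|x|²) xᵢ` — the profile of the regularised Stokeslet pressure vector. [folklore] -/
def E1 (i : Fin 3) (x : 𝔼) : ℝ := 2 * G1 ε (‖x‖ ^ 2) * x i

/-- `∂ₖ∂ᵢΔΦ_ε = 4 G₂ xₖ xᵢ + 2 G₁ δₖᵢ`. [folklore] -/
def E2 (k i : Fin 3) (x : 𝔼) : ℝ := 4 * G2 ε (‖x‖ ^ 2) * x k * x i + 2 * G1 ε (‖x‖ ^ 2) * kd k i

/-- `Δ²Φ_ε = ψ(|x|²) = 15ε⁴/(|x|²+ε²)^{7/2}`, the approximate identity. [folklore] -/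
def Psi (x : 𝔼) : ℝ := psi ε (‖x‖ ^ 2)

variable {ε}


/-- `‖x‖ ≤ t(‖x‖²)`. [folklore] -/
theorem norm_le_rt (x : 𝔼) : ‖x‖ ≤ rt ε (‖x‖ ^ 2) := by
  have := sqrt_le_rt (ε := ε) (‖x‖ ^ 2)
  rwa [Real.sqrt_sq (norm_nonneg _)] at this

/-! Smoothness (for `ε ≠ 0`). -/

/-- `x ↦ t(‖x‖²) = √(‖x‖² + ε²)` is smooth for `ε ≠ 0`. [folklore] -/
theorem contDiff_rt_comp (hε : ε ≠ 0) {n : WithTop ℕ∞} : ContDiff ℝ n (fun x : 𝔼 => rt ε (‖x‖ ^ 2)) := by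
  unfold rt
  exact ((contDiff_norm_sq ℝ).add contDiff_const).sqrt fun x => by positivity

/-- `t(‖x‖²) ≠ 0` for `ε ≠ 0`. [folklore] -/
theorem rt_comp_ne_zero (hε : ε ≠ 0) (x : 𝔼) : rt ε (‖x‖ ^ 2) ≠ 0 :=
  (rt_pos hε (sq_nonneg _)).ne'

/-- `x ↦ g₁(‖x‖²)` is smooth for `ε ≠ 0`. [folklore] -/
theorem contDiff_g1_comp (hε : ε ≠ 0) {n : WithTop ℕ∞} : ContDiff ℝ n (fun x : 𝔼 => g1 ε (‖x‖ ^ 2)) := by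
  unfold g1
  exact contDiff_const.div (contDiff_const.mul (contDiff_rt_comp hε)) fun x =>
    mul_ne_zero two_ne_zero (rt_comp_ne_zero hε x)

/-- `x ↦ g₂(‖x‖²)` is smooth for `ε ≠ 0`. [folklore] -/
theorem contDiff_g2_comp (hε : ε ≠ 0) {n : WithTop ℕ∞} : ContDiff ℝ n (fun x : 𝔼 => g2 ε (‖x‖ ^ 2)) := by
  unfold g2
  exact contDiff_const.div (contDiff_const.mul ((contDiff_rt_comp hε).pow 3)) fun x =>
    mul_ne_zero (by norm_num) (pow_ne_zero _ (rt_comp_ne_zero hε x))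

/-- `x ↦ g₃(‖x‖²)` is smooth for `ε ≠ 0`. [folklore] -/
theorem contDiff_g3_comp (hε : ε ≠ 0) {n : WithTop ℕ∞} : ContDiff ℝ n (fun x : 𝔼 => g3 ε (‖x‖ ^ 2)) := by
  unfold g3
  exact contDiff_const.div (contDiff_const.mul ((contDiff_rt_comp hε).pow 5)) fun x =>
    mul_ne_zero (by norm_num) (pow_ne_zero _ (rt_comp_ne_zero hε x))

/-- `x ↦ g₄(‖x‖²)` is smooth for `ε ≠ 0`. [folklore] -/
theorem contDiff_g4_comp (hε : ε ≠ 0) {n : WithTop ℕ∞} : ContDiff ℝ n (fun x : 𝔼 => g4 ε (‖x‖ ^ 2)) := by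
  unfold g4
  exact contDiff_const.div (contDiff_const.mul ((contDiff_rt_comp hε).pow 7)) fun x =>
    mul_ne_zero (by norm_num) (pow_ne_zero _ (rt_comp_ne_zero hε x))

/-- `x ↦ G₁(‖x‖²)` is smooth for `ε ≠ 0`. [folklore] -/
theorem contDiff_G1_comp (hε : ε ≠ 0) {n : WithTop ℕ∞} : ContDiff ℝ n (fun x : 𝔼 => G1 ε (‖x‖ ^ 2)) := by
  unfold G1
  exact (contDiff_const.mul (contDiff_g2_comp hε)).add
    ((contDiff_const.mul (contDiff_norm_sq ℝ)).mul (contDiff_g3_comp hε))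

/-- `x ↦ G₂(‖x‖²)` is smooth for `ε ≠ 0`. [folklore] -/
theorem contDiff_G2_comp (hε : ε ≠ 0) {n : WithTop ℕ∞} : ContDiff ℝ n (fun x : 𝔼 => G2 ε (‖x‖ ^ 2)) := by
  unfold G2
  exact (contDiff_const.mul (contDiff_g3_comp hε)).add
    ((contDiff_const.mul (contDiff_norm_sq ℝ)).mul (contDiff_g4_comp hε))

/-- `Φ_ε` is smooth for `ε ≠ 0`. [folklore] -/
theorem contDiff_Phi (hε : ε ≠ 0) {n : WithTop ℕ∞} : ContDiff ℝ n (Phi ε) := by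
  unfold Phi g0
  exact (contDiff_rt_comp hε).neg

/-- `D1` is smooth for `ε ≠ 0`. [folklore] -/
theorem contDiff_D1 (hε : ε ≠ 0) (i : Fin 3) {n : WithTop ℕ∞} : ContDiff ℝ n (D1 ε i) := by
  unfold D1
  exact (contDiff_const.mul (contDiff_g1_comp hε)).mul (contDiff_euclideanCoord i)

/-- `D2` is smooth for `ε ≠ 0`. [folklore] -/
theorem contDiff_D2 (hε : ε ≠ 0) (k i : Fin 3) {n : WithTop ℕ∞} : ContDiff ℝ n (D2 ε k i) := by
  unfold D2
  exact (((contDiff_const.mul (contDiff_g2_comp hε)).mul (contDiff_euclideanCoord k)).mul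
    (contDiff_euclideanCoord i)).add ((contDiff_const.mul (contDiff_g1_comp hε)).mul contDiff_const)

/-- `D3` is smooth for `ε ≠ 0`. [folklore] -/
theorem contDiff_D3 (hε : ε ≠ 0) (l k i : Fin 3) {n : WithTop ℕ∞} : ContDiff ℝ n (D3 ε l k i) := by
  unfold D3
  refine ((((contDiff_const.mul (contDiff_g3_comp hε)).mul (contDiff_euclideanCoord l)).mul
    (contDiff_euclideanCoord k)).mul (contDiff_euclideanCoord i)).add
    ((contDiff_const.mul (contDiff_g2_comp hε)).mul ?_)
  exact ((contDiff_const.mul (contDiff_euclideanCoord i)).add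
    (contDiff_const.mul (contDiff_euclideanCoord k))).add (contDiff_const.mul (contDiff_euclideanCoord l))

/-- `ΔΦ_ε` is smooth for `ε ≠ 0`. [folklore] -/
theorem contDiff_Lap (hε : ε ≠ 0) {n : WithTop ℕ∞} : ContDiff ℝ n (Lap ε) := by
  unfold Lap G0
  exact ((contDiff_const.mul (contDiff_norm_sq ℝ)).mul (contDiff_g2_comp hε)).add
    (contDiff_const.mul (contDiff_g1_comp hε))

/-- `E1` is smooth for `ε ≠ 0`. [folklore] -/
theorem contDiff_E1 (hε : ε ≠ 0) (i : Fin 3) {n : WithTop ℕ∞} : ContDiff ℝ n (E1 ε i) := by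
  unfold E1
  exact (contDiff_const.mul (contDiff_G1_comp hε)).mul (contDiff_euclideanCoord i)

/-- `E2` is smooth for `ε ≠ 0`. [folklore] -/
theorem contDiff_E2 (hε : ε ≠ 0) (k i : Fin 3) {n : WithTop ℕ∞} : ContDiff ℝ n (E2 ε k i) := by
  unfold E2
  exact (((contDiff_const.mul (contDiff_G2_comp hε)).mul (contDiff_euclideanCoord k)).mul
    (contDiff_euclideanCoord i)).add ((contDiff_const.mul (contDiff_G1_comp hε)).mul contDiff_const)

/-- `Ψ_ε` is smooth for `ε ≠ 0`. [folklore] -/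
theorem contDiff_Psi (hε : ε ≠ 0) {n : WithTop ℕ∞} : ContDiff ℝ n (Psi ε) := by
  unfold Psi psi
  exact ((contDiff_const.mul (contDiff_norm_sq ℝ)).mul (contDiff_G2_comp hε)).add
    (contDiff_const.mul (contDiff_G1_comp hε))

/-! The chain of coordinate derivatives. -/

/-- `∂ᵢΦ_ε = D1 i`. [folklore] -/
theorem pderiv_Phi (hε : ε ≠ 0) (i : Fin 3) : pderiv i (Phi ε) = D1 ε i := by
  unfold Phi D1
  exact pderiv_comp_norm_sq (fun x => hasDerivAt_g0 hε (sq_nonneg _)) i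

/-- `∂ₖ (D1 i) = D2 k i`. [folklore] -/
theorem pderiv_D1 (hε : ε ≠ 0) (k i : Fin 3) : pderiv k (D1 ε i) = D2 ε k i := by
  have hd1 : Differentiable ℝ (fun x : 𝔼 => 2 * g1 ε (‖x‖ ^ 2)) :=
    (differentiable_comp_norm_sq (fun x => hasDerivAt_g1 hε (sq_nonneg _))).const_mul 2
  have e1 : pderiv k (fun x : 𝔼 => 2 * g1 ε (‖x‖ ^ 2)) = fun x => 2 * (2 * g2 ε (‖x‖ ^ 2) * x k) := by
    rw [pderiv_const_mul (differentiable_comp_norm_sq (fun x => hasDerivAt_g1 hε (sq_nonneg _))),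
      pderiv_comp_norm_sq (fun x => hasDerivAt_g1 hε (sq_nonneg _))]
  unfold D1 D2
  rw [pderiv_mul hd1 (differentiable_euclideanCoord i), e1, pderiv_coord]
  funext x
  rw [kd_comm i k]
  ring

/-- `∂ₗ (D2 k i) = D3 l k i`. [folklore] -/
theorem pderiv_D2 (hε : ε ≠ 0) (l k i : Fin 3) : pderiv l (D2 ε k i) = D3 ε l k i := by
  have hg2 := fun x : 𝔼 => hasDerivAt_g2 hε (sq_nonneg ‖x‖)
  have hg1 := fun x : 𝔼 => hasDerivAt_g1 hε (sq_nonneg ‖x‖)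
  have hd2 : Differentiable ℝ (fun x : 𝔼 => 4 * g2 ε (‖x‖ ^ 2)) :=
    (differentiable_comp_norm_sq hg2).const_mul 4
  have hd1 : Differentiable ℝ (fun x : 𝔼 => 2 * g1 ε (‖x‖ ^ 2)) :=
    (differentiable_comp_norm_sq hg1).const_mul 2
  have e2 : pderiv l (fun x : 𝔼 => 4 * g2 ε (‖x‖ ^ 2)) = fun x => 4 * (2 * g3 ε (‖x‖ ^ 2) * x l) := by
    rw [pderiv_const_mul (differentiable_comp_norm_sq hg2), pderiv_comp_norm_sq hg2]
  have e1 : pderiv l (fun x : 𝔼 => 2 * g1 ε (‖x‖ ^ 2)) = fun x => 2 * (2 * g2 ε (‖x‖ ^ 2) * x l) := by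
    rw [pderiv_const_mul (differentiable_comp_norm_sq hg1), pderiv_comp_norm_sq hg1]
  have hA : Differentiable ℝ (fun x : 𝔼 => 4 * g2 ε (‖x‖ ^ 2) * x k) :=
    hd2.mul (differentiable_euclideanCoord k)
  have eA : pderiv l (fun x : 𝔼 => 4 * g2 ε (‖x‖ ^ 2) * x k) =
      fun x => 4 * (2 * g3 ε (‖x‖ ^ 2) * x l) * x k + 4 * g2 ε (‖x‖ ^ 2) * kd k l := by
    rw [pderiv_mul hd2 (differentiable_euclideanCoord k), e2, pderiv_coord]
  have eB : pderiv l (fun x : 𝔼 => 4 * g2 ε (‖x‖ ^ 2) * x k * x i) =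
      fun x => (4 * (2 * g3 ε (‖x‖ ^ 2) * x l) * x k + 4 * g2 ε (‖x‖ ^ 2) * kd k l) * x i +
        4 * g2 ε (‖x‖ ^ 2) * x k * kd i l := by
    rw [pderiv_mul hA (differentiable_euclideanCoord i), eA, pderiv_coord]
  have eC : pderiv l (fun x : 𝔼 => 2 * g1 ε (‖x‖ ^ 2) * kd k i) =
      fun x => 2 * (2 * g2 ε (‖x‖ ^ 2) * x l) * kd k i := by
    rw [pderiv_mul hd1 (differentiable_const _), e1, pderiv_const]
    funext x; ring
  have hB : Differentiable ℝ (fun x : 𝔼 => 4 * g2 ε (‖x‖ ^ 2) * x k * x i) :=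
    hA.mul (differentiable_euclideanCoord i)
  have hC : Differentiable ℝ (fun x : 𝔼 => 2 * g1 ε (‖x‖ ^ 2) * kd k i) :=
    hd1.mul (differentiable_const _)
  unfold D2 D3
  rw [pderiv_add hB hC, eB, eC]
  funext x
  ring

/-- `∑ₖ ∂ₖ∂ₖΦ_ε = ΔΦ_ε = G₀(|x|²)`. [folklore] -/
theorem sum_D2_diag (x : 𝔼) : ∑ k, D2 ε k k x = Lap ε x := by
  simp only [D2, kd_self, Lap, G0, Fin.sum_univ_three]
  rw [norm_sq_eq_three]
  ring

/-- `∂ᵢ ΔΦ_ε = E1 i`. [folklore] -/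
theorem pderiv_Lap (hε : ε ≠ 0) (i : Fin 3) : pderiv i (Lap ε) = E1 ε i := by
  unfold Lap E1
  exact pderiv_comp_norm_sq (fun x => hasDerivAt_G0 hε (sq_nonneg _)) i

/-- `∂ₖ (E1 i) = E2 k i`. [folklore] -/
theorem pderiv_E1 (hε : ε ≠ 0) (k i : Fin 3) : pderiv k (E1 ε i) = E2 ε k i := by
  have hG := fun x : 𝔼 => hasDerivAt_G1 hε (sq_nonneg ‖x‖)
  have hd1 : Differentiable ℝ (fun x : 𝔼 => 2 * G1 ε (‖x‖ ^ 2)) :=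
    (differentiable_comp_norm_sq hG).const_mul 2
  have e1 : pderiv k (fun x : 𝔼 => 2 * G1 ε (‖x‖ ^ 2)) = fun x => 2 * (2 * G2 ε (‖x‖ ^ 2) * x k) := by
    rw [pderiv_const_mul (differentiable_comp_norm_sq hG), pderiv_comp_norm_sq hG]
  unfold E1 E2
  rw [pderiv_mul hd1 (differentiable_euclideanCoord i), e1, pderiv_coord]
  funext x
  rw [kd_comm i k]
  ring

/-- `∑ₖ ∂ₖ∂ₖ ΔΦ_ε = Δ²Φ_ε = ψ(|x|²)`. [folklore] -/
theorem sum_E2_diag (x : 𝔼) : ∑ k, E2 ε k k x = Psi ε x := by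
  simp only [E2, kd_self, Psi, psi, Fin.sum_univ_three]
  rw [norm_sq_eq_three]
  ring

/-- `∑ₖ ∂ₖ∂ₖ ∂ᵢΦ_ε = ∂ᵢ ΔΦ_ε`, from the explicit formulas. [folklore] -/
theorem sum_D3_diag (x : 𝔼) (i : Fin 3) : ∑ k, D3 ε k k i x = E1 ε i x := by
  simp only [D3, kd_self, E1, G1, Fin.sum_univ_three]
  fin_cases i <;> simp [kd] <;> rw [norm_sq_eq_three] <;> ring

/-- `∂ₖ∂ᵢΦ_ε = ∂ᵢ∂ₖΦ_ε` (symmetry of the explicit Hessian). [folklore] -/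
theorem D2_comm (k i : Fin 3) (x : 𝔼) : D2 ε k i x = D2 ε i k x := by
  simp only [D2, kd_comm k i]; ring

/-- `∂ₖ∂ᵢΔΦ_ε = ∂ᵢ∂ₖΔΦ_ε`. [folklore] -/
theorem E2_comm (k i : Fin 3) (x : 𝔼) : E2 ε k i x = E2 ε i k x := by
  simp only [E2, kd_comm k i]; ring

/-! Pointwise bounds, uniform in `ε ≠ 0`. -/

/-- `|δₖᵢ| ≤ 1`. [folklore] -/
theorem abs_kd_le_one (k i : Fin 3) : |kd k i| ≤ 1 := by
  unfold kd; split_ifs <;> simp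

/-- `0 ≤ δₖᵢ`. [folklore] -/
theorem kd_nonneg (k i : Fin 3) : 0 ≤ kd k i := by
  unfold kd; split_ifs <;> norm_num

/-- `|∂ᵢΦ_ε| ≤ 1`. [folklore] -/
theorem abs_D1_le (hε : ε ≠ 0) (i : Fin 3) (x : 𝔼) : |D1 ε i x| ≤ 1 := by
  have ht := rt_pos hε (sq_nonneg ‖x‖)
  have hxt := norm_le_rt (ε := ε) x
  have hxi := abs_coord_le_norm x i
  rw [D1, abs_mul, abs_mul, abs_g1 hε (sq_nonneg _), abs_two]
  rw [show 2 * (1 / (2 * rt ε (‖x‖ ^ 2))) * |x i| = |x i| / rt ε (‖x‖ ^ 2) by field_simp]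
  rw [div_le_one ht]
  linarith

/-- `|∂ₖ∂ᵢΦ_ε| ≤ 2/t ≤ 2/‖x‖`. [folklore] -/
theorem abs_D2_le_rt (hε : ε ≠ 0) (k i : Fin 3) (x : 𝔼) : |D2 ε k i x| ≤ 2 / rt ε (‖x‖ ^ 2) := by
  have ht := rt_pos hε (sq_nonneg ‖x‖)
  have hxt := norm_le_rt (ε := ε) x
  have hxi := abs_coord_le_norm x i
  have hxk := abs_coord_le_norm x k
  have h1 : |4 * g2 ε (‖x‖ ^ 2) * x k * x i| ≤ 1 / rt ε (‖x‖ ^ 2) := by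
    rw [abs_mul, abs_mul, abs_mul, abs_g2 hε (sq_nonneg _)]
    rw [show |(4:ℝ)| * (1 / (4 * rt ε (‖x‖ ^ 2) ^ 3)) * |x k| * |x i| =
      (|x k| * |x i|) / rt ε (‖x‖ ^ 2) ^ 3 by rw [abs_of_pos (by norm_num : (0:ℝ) < 4)]; field_simp]
    rw [div_le_div_iff₀ (by positivity) ht]
    have : |x k| * |x i| ≤ rt ε (‖x‖ ^ 2) * rt ε (‖x‖ ^ 2) :=
      mul_le_mul (hxk.trans hxt) (hxi.trans hxt) (abs_nonneg _) ht.le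
    nlinarith [this, ht]
  have h2 : |2 * g1 ε (‖x‖ ^ 2) * kd k i| ≤ 1 / rt ε (‖x‖ ^ 2) := by
    rw [abs_mul, abs_mul, abs_g1 hε (sq_nonneg _), abs_two]
    calc 2 * (1 / (2 * rt ε (‖x‖ ^ 2))) * |kd k i| ≤ 2 * (1 / (2 * rt ε (‖x‖ ^ 2))) * 1 := by
          gcongr; exact abs_kd_le_one k i
      _ = 1 / rt ε (‖x‖ ^ 2) := by field_simp
  calc |D2 ε k i x| ≤ |4 * g2 ε (‖x‖ ^ 2) * x k * x i| + |2 * g1 ε (‖x‖ ^ 2) * kd k i| := abs_add_le _ _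
    _ ≤ 1 / rt ε (‖x‖ ^ 2) + 1 / rt ε (‖x‖ ^ 2) := add_le_add h1 h2
    _ = 2 / rt ε (‖x‖ ^ 2) := by ring

/-- `|∂ₖ∂ᵢΦ_ε| ≤ 2/‖x‖` for `x ≠ 0`. [folklore] -/
theorem abs_D2_le (hε : ε ≠ 0) (k i : Fin 3) {x : 𝔼} (hx : x ≠ 0) : |D2 ε k i x| ≤ 2 / ‖x‖ :=
  (abs_D2_le_rt hε k i x).trans
    (div_le_div_of_nonneg_left (by norm_num) (norm_pos_iff.2 hx) (norm_le_rt x))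

/-- `|∂ₗ∂ₖ∂ᵢΦ_ε| ≤ 6/‖x‖²`. [folklore] -/
theorem abs_D3_le (hε : ε ≠ 0) (l k i : Fin 3) {x : 𝔼} (hx : x ≠ 0) : |D3 ε l k i x| ≤ 6 / ‖x‖ ^ 2 := by
  have ht := rt_pos hε (sq_nonneg ‖x‖)
  have hxt := norm_le_rt (ε := ε) x
  have hx0 := norm_pos_iff.2 hx
  have hxi := abs_coord_le_norm x i
  have hxk := abs_coord_le_norm x k
  have hxl := abs_coord_le_norm x l
  have h1 : |8 * g3 ε (‖x‖ ^ 2) * x l * x k * x i| ≤ 3 / ‖x‖ ^ 2 := by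
    rw [abs_mul, abs_mul, abs_mul, abs_mul, abs_g3 hε (sq_nonneg _),
      abs_of_pos (by norm_num : (0:ℝ) < 8)]
    rw [show (8:ℝ) * (3 / (8 * rt ε (‖x‖ ^ 2) ^ 5)) * |x l| * |x k| * |x i| =
      3 * (|x l| * |x k| * |x i|) / rt ε (‖x‖ ^ 2) ^ 5 by field_simp]
    rw [div_le_div_iff₀ (by positivity) (by positivity)]
    have h3 : |x l| * |x k| * |x i| ≤ ‖x‖ * ‖x‖ * ‖x‖ := by
      apply mul_le_mul (mul_le_mul hxl hxk (abs_nonneg _) (norm_nonneg _)) hxi (abs_nonneg _)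
      positivity
    have h5 : ‖x‖ ^ 5 ≤ rt ε (‖x‖ ^ 2) ^ 5 := pow_le_pow_left₀ (norm_nonneg _) hxt 5
    nlinarith [h3, h5, pow_pos hx0 2, pow_pos hx0 3]
  have h2 : |4 * g2 ε (‖x‖ ^ 2) * (kd k l * x i + kd i l * x k + kd k i * x l)| ≤ 3 / ‖x‖ ^ 2 := by
    rw [abs_mul, abs_mul, abs_g2 hε (sq_nonneg _), abs_of_pos (by norm_num : (0:ℝ) < 4)]
    have hb : |kd k l * x i + kd i l * x k + kd k i * x l| ≤ 3 * ‖x‖ := by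
      have e1 : |kd k l * x i| ≤ ‖x‖ := by
        rw [abs_mul]; exact (mul_le_mul (abs_kd_le_one _ _) hxi (abs_nonneg _) zero_le_one).trans (by simp)
      have e2 : |kd i l * x k| ≤ ‖x‖ := by
        rw [abs_mul]; exact (mul_le_mul (abs_kd_le_one _ _) hxk (abs_nonneg _) zero_le_one).trans (by simp)
      have e3 : |kd k i * x l| ≤ ‖x‖ := by
        rw [abs_mul]; exact (mul_le_mul (abs_kd_le_one _ _) hxl (abs_nonneg _) zero_le_one).trans (by simp)
      calc _ ≤ |kd k l * x i + kd i l * x k| + |kd k i * x l| := abs_add_le _ _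
        _ ≤ (|kd k l * x i| + |kd i l * x k|) + |kd k i * x l| := by gcongr; exact abs_add_le _ _
        _ ≤ (‖x‖ + ‖x‖) + ‖x‖ := by gcongr
        _ = 3 * ‖x‖ := by ring
    calc (4:ℝ) * (1 / (4 * rt ε (‖x‖ ^ 2) ^ 3)) * |kd k l * x i + kd i l * x k + kd k i * x l|
        ≤ 4 * (1 / (4 * rt ε (‖x‖ ^ 2) ^ 3)) * (3 * ‖x‖) := by gcongr
      _ = 3 * ‖x‖ / rt ε (‖x‖ ^ 2) ^ 3 := by field_simp
      _ ≤ 3 * ‖x‖ / ‖x‖ ^ 3 := by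
          apply div_le_div_of_nonneg_left (by positivity) (by positivity)
          exact pow_le_pow_left₀ (norm_nonneg _) hxt 3
      _ = 3 / ‖x‖ ^ 2 := by field_simp
  calc |D3 ε l k i x| ≤ _ := abs_add_le _ _
    _ ≤ 3 / ‖x‖ ^ 2 + 3 / ‖x‖ ^ 2 := add_le_add h1 h2
    _ = 6 / ‖x‖ ^ 2 := by ring

/-- `|ΔΦ_ε| ≤ 3/‖x‖`. [folklore] -/
theorem abs_Lap_le (hε : ε ≠ 0) {x : 𝔼} (hx : x ≠ 0) : |Lap ε x| ≤ 3 / ‖x‖ :=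
  (abs_G0_le hε (sq_nonneg _)).trans
    (div_le_div_of_nonneg_left (by norm_num) (norm_pos_iff.2 hx) (norm_le_rt x))

/-- `|∂ᵢΔΦ_ε| ≤ 5/‖x‖²`. [folklore] -/
theorem abs_E1_le (hε : ε ≠ 0) (i : Fin 3) {x : 𝔼} (hx : x ≠ 0) : |E1 ε i x| ≤ 5 / ‖x‖ ^ 2 := by
  have ht := rt_pos hε (sq_nonneg ‖x‖)
  have hxt := norm_le_rt (ε := ε) x
  have hx0 := norm_pos_iff.2 hx
  have hxi := abs_coord_le_norm x i
  rw [E1, abs_mul, abs_mul, abs_two]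
  calc 2 * |G1 ε (‖x‖ ^ 2)| * |x i| ≤ 2 * (5 / (2 * rt ε (‖x‖ ^ 2) ^ 3)) * ‖x‖ := by
        gcongr; exact abs_G1_le hε (sq_nonneg _)
    _ = 5 * ‖x‖ / rt ε (‖x‖ ^ 2) ^ 3 := by field_simp
    _ ≤ 5 * ‖x‖ / ‖x‖ ^ 3 := by
        apply div_le_div_of_nonneg_left (by positivity) (by positivity)
        exact pow_le_pow_left₀ (norm_nonneg _) hxt 3
    _ = 5 / ‖x‖ ^ 2 := by field_simp

/-! The bump `Ψ_ε = Δ²Φ_ε`: closed form, positivity, scaling, integrability. -/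

/-- `Ψ_ε(x) = 15 ε⁴ / t(|x|²)⁷`. [folklore] -/
theorem Psi_eq (hε : ε ≠ 0) (x : 𝔼) : Psi ε x = 15 * ε ^ 4 / rt ε (‖x‖ ^ 2) ^ 7 :=
  psi_eq hε (sq_nonneg _)

/-- `Ψ_ε > 0` for `ε ≠ 0`. [folklore] -/
theorem Psi_pos (hε : ε ≠ 0) (x : 𝔼) : 0 < Psi ε x := psi_pos hε (sq_nonneg _)

/-- `Ψ₁(u) = 15 (1 + ‖u‖²)^{-7/2}`. [folklore] -/
theorem Psi_one_eq (u : 𝔼) : Psi 1 u = 15 * (1 + ‖u‖ ^ 2) ^ (-(7 : ℝ) / 2) := by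
  rw [Psi_eq one_ne_zero]
  simp only [rt, one_pow, mul_one]
  have h0 : 0 < 1 + ‖u‖ ^ 2 := by positivity
  rw [add_comm (‖u‖ ^ 2) 1, Real.sqrt_eq_rpow, ← Real.rpow_natCast, ← Real.rpow_mul h0.le,
    show -(7:ℝ) / 2 = -((1:ℝ) / 2 * ((7:ℕ) : ℝ)) by norm_num, Real.rpow_neg h0.le, div_eq_mul_inv]

/-- **Scaling**: `Ψ_ε(x) = ε⁻³ Ψ₁(ε⁻¹ x)` for `ε > 0`. [folklore] -/
theorem Psi_scale {ε : ℝ} (hε : 0 < ε) (x : 𝔼) : Psi ε x = ε⁻¹ ^ 3 * Psi 1 (ε⁻¹ • x) := by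
  rw [Psi_eq hε.ne', Psi_eq one_ne_zero]
  simp only [rt, norm_smul, Real.norm_eq_abs, abs_inv, abs_of_pos hε, one_pow, mul_one]
  have e : (ε⁻¹ * ‖x‖) ^ 2 + 1 = (ε⁻¹) ^ 2 * (‖x‖ ^ 2 + ε ^ 2) := by
    field_simp
  rw [e, Real.sqrt_mul (by positivity), Real.sqrt_sq (by positivity)]
  have hs : 0 < Real.sqrt (‖x‖ ^ 2 + ε ^ 2) := Real.sqrt_pos.2 (by positivity)
  field_simp

/-- `Ψ₁` is integrable on `ℝ³` (`(1+|u|²)^{-7/2}`, `7 > 3`). [folklore] -/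
theorem integrable_Psi_one : Integrable (Psi 1 : 𝔼 → ℝ) := by
  have h : Integrable (fun u : 𝔼 => ((1 : ℝ) + ‖u‖ ^ 2) ^ (-(7 : ℝ) / 2)) := by
    apply integrable_rpow_neg_one_add_norm_sq
    rw [finrank_euclideanSpace, Fintype.card_fin]
    norm_num
  have e : (Psi 1 : 𝔼 → ℝ) = fun u => 15 * ((1 : ℝ) + ‖u‖ ^ 2) ^ (-(7 : ℝ) / 2) := by
    funext u; exact Psi_one_eq u
  rw [e]
  exact h.const_mul 15

/-- The mass `M = ∫ Ψ₁ > 0`. [folklore] -/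
theorem integral_Psi_one_pos : 0 < ∫ u, Psi 1 u ∂(volume : Measure 𝔼) := by
  refine (integral_pos_iff_support_of_nonneg (fun u => (Psi_pos one_ne_zero u).le)
    integrable_Psi_one).2 ?_
  have : Function.support (Psi 1 : 𝔼 → ℝ) = Set.univ := by
    ext u; simp [(Psi_pos one_ne_zero u).ne']
  rw [this]
  simp

/-- Decay: `‖u‖³ Ψ₁(u) → 0` at infinity (`Ψ₁(u) ≤ 15 ‖u‖⁻⁷`). [folklore] -/
theorem tendsto_norm_pow_mul_Psi_one :
    Tendsto (fun u : 𝔼 => ‖u‖ ^ Module.finrank ℝ 𝔼 * Psi 1 u) (Bornology.cobounded 𝔼) (𝓝 0) := by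
  rw [finrank_euclideanSpace, Fintype.card_fin]
  have hb : ∀ u : 𝔼, u ≠ 0 → ‖u‖ ^ 3 * Psi 1 u ≤ 15 * (‖u‖ ^ 4)⁻¹ := by
    intro u hu
    have hu0 := norm_pos_iff.2 hu
    have hxt := norm_le_rt (ε := (1:ℝ)) u
    have ht : 0 < rt 1 (‖u‖ ^ 2) := rt_pos one_ne_zero (sq_nonneg _)
    rw [Psi_eq one_ne_zero, one_pow]
    rw [show ‖u‖ ^ 3 * (15 * 1 / rt 1 (‖u‖ ^ 2) ^ 7) = 15 * ‖u‖ ^ 3 / rt 1 (‖u‖ ^ 2) ^ 7 by ring]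
    rw [show 15 * (‖u‖ ^ 4)⁻¹ = 15 * ‖u‖ ^ 3 / ‖u‖ ^ 7 by field_simp]
    apply div_le_div_of_nonneg_left (by positivity) (by positivity)
    exact pow_le_pow_left₀ (norm_nonneg _) hxt 7
  have hlim : Tendsto (fun u : 𝔼 => 15 * (‖u‖ ^ 4)⁻¹) (Bornology.cobounded 𝔼) (𝓝 0) := by
    have h1 : Tendsto (fun u : 𝔼 => ‖u‖ ^ 4) (Bornology.cobounded 𝔼) atTop :=
      (tendsto_pow_atTop (by norm_num)).comp tendsto_norm_cobounded_atTop
    have h2 := tendsto_inv_atTop_zero.comp h1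
    simpa using h2.const_mul 15
  refine squeeze_zero' ?_ ?_ hlim
  · filter_upwards with u
    exact mul_nonneg (by positivity) (Psi_pos one_ne_zero u).le
  · have : ({0} : Set 𝔼)ᶜ ∈ Bornology.cobounded 𝔼 := Bornology.isBounded_singleton
    filter_upwards [this] with u hu
    exact hb u (by simpa using hu)

end Potential


end Stokeslet

end Literature.Analysis.FluidPDE
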